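import Mathlib.Analysis.Analytic.Order
import Mathlib.Analysis.Calculus.IteratedDeriv.Defs
import Mathlib.Analysis.Complex.CauchyIntegral
import Literature.NumberTheory.GaloisRepresentations.ArtinLFunction
import Literature.NumberTheory.EllipticCurves.AnalyticRank
import HarnessLib

-- provenance: harness21/H21/H21/Prelude/ArithGeomL/EntireContinuation.lean @ 11d6612 (interim HEAD d8f2665); M5 mechanical rewrite
/-!
# Entire continuation from a half-plane and the analytic rank (generic package)

Trunk ArithGeomL (outline `ArithGeomL`, item C4a `EntireContinuation`), notions `analytic_rank`,
`hasse_weil_L_abelian_variety`.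

An L-function `f : ℂ → ℂ` is typically given by an Euler product / Dirichlet series converging
absolutely on a right half-plane `re s > c` (Artin L-functions: `c = 1`; Hasse–Weil L-functions
of elliptic curves / abelian varieties in the arithmetic normalisation: `c = 3/2`), with junk
values elsewhere. This file packages, once and generically in the abscissa `c`:

* `Literature.LFunction.entireContinuationsFrom c f`: the set of entire `g` agreeing with `f` on
  `re s > c` (a subsingleton by the identity theorem, `subsingleton_entireContinuationsFrom`);
* `Literature.LFunction.HasEntireContinuationFrom c f`: nonemptiness of that set, monotone in `c`;
  for `c = 1` this is G09's `Literature.NumberTheory.GaloisRepresentations.LFunction.HasEntireContinuation` (`hasEntireContinuation_iff`);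
  a predicate on `(c, f)` (inhabited by entire `f`, false for `f s = (s - c)⁻¹`: see the sibling
  file `EntireContinuationProofs.lean`), not a closed named fact;
* `Literature.LFunction.entireContinuationFrom c f`: the continuation (junk value `f` if none exists);
* `Literature.LFunction.analyticRankAt c f s₀ = ord_{s = s₀}` of the continuation (Mathlib
  `analyticOrderNatAt`) and `Literature.LFunction.leadingCoeffAt c f s₀`, its leading Taylor
  coefficient at `s₀`;
* bridges showing that the elliptic-curve package of `Literature.Prelude.TranscendEllArithS.AnalyticRank`
  (G06: `WeierstrassCurve.entireContinuations`, `analyticRank`, `leadingLCoeff`) is literally the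
  instance `c = 3/2`, `f = W.LSeries`, `s₀ = 1` (`rfl` lemmas).

## Design notes

* Namespace `Literature.LFunction`, the namespace of G09's continuation predicates
  (`Literature.Prelude.GalRep.ArtinLFunction`), which this file extends.
* The abscissa `c : ℝ` is an explicit *parameter* rather than normalising every L-function to
  converge on `re s > 1` (motivic shift `s ↦ s + 1/2`), so that both the Artin shape (`c = 1`)
  and the elliptic-curve shape (`c = 3/2`) are literal instances.
* The function-field package of G16 (`FunctionFieldEllipticL`) uses *meromorphic* continuations
  analytic at `1`, a different shape; it is not an instance of this file.
* Mathlib has `analyticOrderAt` / `analyticOrderNatAt`, `iteratedDeriv`, the identity theorem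
  `AnalyticOnNhd.eq_of_eventuallyEq` and `analyticOrderAt_eq_nat_iff_iteratedDeriv_eq_zero`
  (all used), but no notion of continuation of an L-function from a half-plane and no analytic
  rank (searched `analyticRank`, `Continuation` in `Mathlib/NumberTheory`, `Mathlib/Analysis`).

## References

* J. Neukirch, *Algebraic Number Theory*, Ch. VII §5 (analytic continuation of L-series).
* J. Silverman, *The Arithmetic of Elliptic Curves*, App. C §16.
* B. Birch, H. P. F. Swinnerton-Dyer, *Notes on elliptic curves II*, J. reine angew. Math. 218
  (1965) (analytic rank, leading coefficient).
-/

noncomputable section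

open scoped Classical

open Complex Filter Topology

namespace Literature.NumberTheory.DiophantineGeometry

namespace LFunction

variable (c : ℝ) (f : ℂ → ℂ)

/-- The set of entire continuations of `f` from the half-plane `re s > c`: functions
`g : ℂ → ℂ`, complex differentiable everywhere, with `g s = f s` whenever `c < re s`.
At most one such `g` exists (`subsingleton_entireContinuationsFrom`).
Ref: Neukirch, *Algebraic Number Theory*, VII §5; Silverman AEC C.16. [folklore] -/
def entireContinuationsFrom : Set (ℂ → ℂ) :=
  {g | Differentiable ℂ g ∧ ∀ s : ℂ, c < s.re → g s = f s}

variable {c f} in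
/-- Membership in `entireContinuationsFrom c f`, unfolded.
Ref: Neukirch, *Algebraic Number Theory*, VII §5. [folklore] -/
@[simp] theorem mem_entireContinuationsFrom {g : ℂ → ℂ} :
    g ∈ entireContinuationsFrom c f ↔ Differentiable ℂ g ∧ ∀ s : ℂ, c < s.re → g s = f s :=
  Iff.rfl

/-- Uniqueness of the entire continuation: two entire functions agreeing with `f` on the
half-plane `re s > c` are equal (identity theorem on the connected space `ℂ`;
Neukirch, *Algebraic Number Theory*, VII §5). [folklore] -/
theorem subsingleton_entireContinuationsFrom : (entireContinuationsFrom c f).Subsingleton := by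
  intro g hg g' hg'
  refine AnalyticOnNhd.eq_of_eventuallyEq (z₀ := ((c : ℂ) + 1))
    (hg.1.differentiableOn.analyticOnNhd isOpen_univ)
    (hg'.1.differentiableOn.analyticOnNhd isOpen_univ) ?_
  have hopen : IsOpen {s : ℂ | c < s.re} := isOpen_lt continuous_const Complex.continuous_re
  filter_upwards [hopen.mem_nhds (show c < ((c : ℂ) + 1).re by simp)] with s hs
  rw [hg.2 s hs, hg'.2 s hs]

/-- `HasEntireContinuationFrom c f`: `f` admits an entire continuation from the half-plane
`re s > c`, i.e. `entireContinuationsFrom c f` is nonempty. For `c = 1` this is G09's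
`LFunction.HasEntireContinuation` (`hasEntireContinuation_iff`); for `c = 3/2`, `f = W.LSeries`
it is G06's `WeierstrassCurve.HasEntireLFunction`.
This is a *predicate* on the pair `(c, f)` — a property to be assumed or proved of a given
L-function (`(h : HasEntireContinuationFrom c f)`), not a closed statement: it holds for entire
`f` (`hasEntireContinuationFrom_of_differentiable`) and fails for `f s = (s - c)⁻¹`
(`not_hasEntireContinuationFrom_inv_sub`, both in `EntireContinuationProofs.lean`). The binders
`(c : ℝ) (f : ℂ → ℂ)` are written explicitly (shadowing the section variables) so that the
declaration reads as the two-argument predicate it elaborates to.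
Ref: Neukirch, *Algebraic Number Theory*, VII §5; Silverman AEC C.16. [folklore] -/
def HasEntireContinuationFrom (c : ℝ) (f : ℂ → ℂ) : Prop :=
  (entireContinuationsFrom c f).Nonempty

variable {c f} in
/-- Monotonicity in the abscissa: a continuation from `re s > c` is a continuation from the
smaller half-plane `re s > c'` for `c ≤ c'`. Ref: Neukirch, *Algebraic Number Theory*, VII §5. [folklore] -/
theorem HasEntireContinuationFrom.mono {c' : ℝ} (h : HasEntireContinuationFrom c f)
    (hcc' : c ≤ c') : HasEntireContinuationFrom c' f := by
  obtain ⟨g, hg, hgf⟩ := h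
  exact ⟨g, hg, fun s hs => hgf s (lt_of_le_of_lt hcc' hs)⟩

/-- G09's `LFunction.HasEntireContinuation f` (threshold `re s > 1`) is
`HasEntireContinuationFrom 1 f`. Ref: Neukirch, *Algebraic Number Theory*, VII §5. [folklore] -/
theorem hasEntireContinuation_iff :
    GaloisRepresentations.LFunction.HasEntireContinuation f ↔ HasEntireContinuationFrom 1 f := by
  simp only [GaloisRepresentations.LFunction.HasEntireContinuation, HasEntireContinuationFrom, Set.Nonempty,
    mem_entireContinuationsFrom]

/-- The entire continuation of `f` from `re s > c`: the (unique) element of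
`entireContinuationsFrom c f`, chosen classically. Junk value: if no entire continuation
exists, this is `f` itself (same convention as G06 `WeierstrassCurve.entireLFunction`).
Ref: Neukirch, *Algebraic Number Theory*, VII §5; Silverman AEC C.16. [folklore] -/
def entireContinuationFrom : ℂ → ℂ :=
  if h : HasEntireContinuationFrom c f then h.some else f

variable {c f}

/-- If `f` has an entire continuation from `re s > c`, `entireContinuationFrom c f` is one.
Ref: Neukirch, *Algebraic Number Theory*, VII §5. [folklore] -/
theorem entireContinuationFrom_mem (h : HasEntireContinuationFrom c f) :
    entireContinuationFrom c f ∈ entireContinuationsFrom c f := by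
  unfold entireContinuationFrom
  rw [dif_pos h]
  exact h.some_mem

/-- If `f` has an entire continuation from `re s > c`, `entireContinuationFrom c f` is complex
differentiable everywhere. Ref: Neukirch, *Algebraic Number Theory*, VII §5. [folklore] -/
theorem differentiable_entireContinuationFrom (h : HasEntireContinuationFrom c f) :
    Differentiable ℂ (entireContinuationFrom c f) :=
  (entireContinuationFrom_mem h).1

/-- If `f` has an entire continuation from `re s > c`, then `entireContinuationFrom c f s = f s`
for `c < re s`. Ref: Neukirch, *Algebraic Number Theory*, VII §5. [folklore] -/
theorem entireContinuationFrom_eq (h : HasEntireContinuationFrom c f) {s : ℂ} (hs : c < s.re) :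
    entireContinuationFrom c f s = f s :=
  (entireContinuationFrom_mem h).2 s hs

/-- Any entire continuation `g` of `f` from `re s > c` *is* `entireContinuationFrom c f`
(uniqueness, `subsingleton_entireContinuationsFrom`).
Ref: Neukirch, *Algebraic Number Theory*, VII §5. [folklore] -/
theorem entireContinuationFrom_eq_of_mem {g : ℂ → ℂ} (hg : g ∈ entireContinuationsFrom c f) :
    entireContinuationFrom c f = g :=
  subsingleton_entireContinuationsFrom c f (entireContinuationFrom_mem ⟨g, hg⟩) hg

/-! ### Analytic rank and leading coefficient -/

variable (c f)

/-- The analytic rank of `f` at `s₀`: the order of vanishing `ord_{s = s₀}` of the entire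
continuation `entireContinuationFrom c f` (Birch–Swinnerton-Dyer 1965; Silverman AEC C.16).
Defined via Mathlib's `analyticOrderNatAt`, so it is `0` (junk) if the continuation is not
analytic at `s₀` or vanishes identically near `s₀`. [cite: BirchSwinnertonDyer1965] -/
def analyticRankAt (s₀ : ℂ) : ℕ :=
  analyticOrderNatAt (entireContinuationFrom c f) s₀

/-- The leading Taylor coefficient of the entire continuation `g = entireContinuationFrom c f`
at `s₀`: `g^{(r)}(s₀) / r!` with `r = analyticRankAt c f s₀`, so that
`g(s) ∼ leadingCoeffAt c f s₀ · (s - s₀)^r` as `s → s₀` (Birch–Swinnerton-Dyer 1965, the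
quantity predicted by BSD-type formulas). [cite: BirchSwinnertonDyer1965, the quantity predicted by BSD-type formu] -/
def leadingCoeffAt (s₀ : ℂ) : ℂ :=
  iteratedDeriv (analyticRankAt c f s₀) (entireContinuationFrom c f) s₀ /
    ((analyticRankAt c f s₀).factorial : ℂ)

variable {c f}

/-- The leading Taylor coefficient at `s₀` is nonzero as soon as the entire continuation exists
and is not identically zero near `s₀` (definition of the order of vanishing;
Birch–Swinnerton-Dyer 1965). [cite: BirchSwinnertonDyer1965] -/
theorem leadingCoeffAt_ne_zero {s₀ : ℂ} (h : HasEntireContinuationFrom c f)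
    (hne : analyticOrderAt (entireContinuationFrom c f) s₀ ≠ ⊤) :
    leadingCoeffAt c f s₀ ≠ 0 := by
  have han : AnalyticAt ℂ (entireContinuationFrom c f) s₀ :=
    (differentiable_entireContinuationFrom h).analyticAt s₀
  have hr : analyticOrderAt (entireContinuationFrom c f) s₀ = (analyticRankAt c f s₀ : ℕ∞) :=
    (ENat.coe_toNat hne).symm
  have hd := ((analyticOrderAt_eq_nat_iff_iteratedDeriv_eq_zero han).mp hr).2
  unfold leadingCoeffAt
  exact div_ne_zero hd (by exact_mod_cast (analyticRankAt c f s₀).factorial_ne_zero)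

end LFunction

end Literature.NumberTheory.DiophantineGeometry

/-! ### Bridges: the elliptic-curve package (G06) is the instance `c = 3/2`

Deliberate dot-notation extensions in `namespace WeierstrassCurve` (Mathlib namespace), next to
G06's `WeierstrassCurve.entireContinuations` / `analyticRank` / `leadingLCoeff`. -/

namespace WeierstrassCurve

variable {K : Type*} [Field K] [NumberField K] (W : WeierstrassCurve K)

/-- G06's set of entire continuations of `L(W,s)` from `re s > 3/2` is
`Literature.LFunction.entireContinuationsFrom (3/2) W.LSeries` (Silverman AEC C.16). [folklore] -/
theorem entireContinuations_eq :
    W.entireContinuations = Literature.NumberTheory.DiophantineGeometry.LFunction.entireContinuationsFrom (3 / 2) W.LSeries :=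
  rfl

/-- G06's `W.HasEntireLFunction` is `Literature.LFunction.HasEntireContinuationFrom (3/2) W.LSeries`
(Silverman AEC C.16). [folklore] -/
theorem hasEntireLFunction_iff :
    W.HasEntireLFunction ↔ Literature.NumberTheory.DiophantineGeometry.LFunction.HasEntireContinuationFrom (3 / 2) W.LSeries :=
  Iff.rfl

/-- G06's `W.entireLFunction` is `Literature.LFunction.entireContinuationFrom (3/2) W.LSeries`
(same junk convention; Silverman AEC C.16). [folklore] -/
theorem entireLFunction_eq :
    W.entireLFunction = Literature.NumberTheory.DiophantineGeometry.LFunction.entireContinuationFrom (3 / 2) W.LSeries :=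
  rfl

/-- G06's analytic rank `ord_{s=1} L(W,s)` is `Literature.LFunction.analyticRankAt (3/2) W.LSeries 1`
(Birch–Swinnerton-Dyer 1965). [cite: BirchSwinnertonDyer1965] -/
theorem analyticRank_eq_analyticRankAt :
    W.analyticRank = Literature.NumberTheory.DiophantineGeometry.LFunction.analyticRankAt (3 / 2) W.LSeries 1 :=
  rfl

/-- G06's leading coefficient `L^{(r)}(W,1)/r!` is
`Literature.LFunction.leadingCoeffAt (3/2) W.LSeries 1` (Birch–Swinnerton-Dyer 1965). [cite: BirchSwinnertonDyer1965] -/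
theorem leadingLCoeff_eq_leadingCoeffAt :
    W.leadingLCoeff = Literature.NumberTheory.DiophantineGeometry.LFunction.leadingCoeffAt (3 / 2) W.LSeries 1 :=
  rfl

end WeierstrassCurve

end
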